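import Literature.Computability.Complexity.GateEliminationSubst

/-!
# Gate elimination, V: the acyclic part evaluates and the xor-part is affine

Foundations for the cyclic xor-part of fair semicircuits (Li–Yang, STOC 2022, Def. 2.5 and §2.5;
full version ECCC TR21-023, pp. 10–11), needed for xor-reconstruction (Prop. 2.7–2.8) and for
excluding degenerate cyclic configurations in the case analysis of Thm. 4.1. No matrices: all
statements are about solution sets. Everything is PROVED.

* `GateEq`, `XorConsistent`, `AcyclicConsistent`, `consistent_iff_xor_acyclic` — the gate
  equations split into the cyclic xor-part `C₁` and the acyclic part `C₂`;
  `XorConsistent.congr`: the xor-part equations only involve xor-part values.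
* **The acyclic part evaluates**: `exists_acyclicConsistent` (any values on the xor-part extend
  to values satisfying all acyclic equations — by iterated relaxation along the rank function
  `rank` of `C.acyclic`) and `acyclicConsistent_unique`.
* **Fairness restricted to the xor-part**: `Fair.xor_unique` — two solutions of the xor-part
  equations on the same input agree on the xor-part ("the cyclic xor-circuit is fair if … this
  system of linear equations has a unique solution", §2.5); `XorConsistent.exists_consistent`.
* **Affineness**: `XorConsistent.xor3` (the xor of three solutions on three inputs solves on the
  xor of the inputs), the solution map `sol` of a fair semicircuit and `sol_xor3`
  (`sol (x₁ ⊕ x₂ ⊕ x₃) = sol x₁ ⊕ sol x₂ ⊕ sol x₃` on the xor-part), and `DependsOn`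
  (gate `I` of the xor-part depends on `x_i`: flipping `x_i` flips `I`; by affineness at one
  input iff at all, `dependsOn_of_exists`) — the hypothesis of Prop. 2.7.

## References

* J. Li, T. Yang, *3.1n − o(n) circuit lower bounds for explicit functions*, STOC 2022
  [LiYang2022]; full version ECCC TR21-023, Def. 2.5, §2.5–2.6, Prop. 2.7.
-/

namespace Literature.Computability.Complexity

open Finset


namespace Semicircuit

variable {n : ℕ} (C : Semicircuit n)

/-! ### Splitting the gate equations -/

/-- The gate equation of gate `j` holds for the values `w` on input `x`. [cite: LiYang2022, §2.5] -/
def GateEq (x : Fin n → Bool) (w : Fin C.m → Bool) (j : Fin C.m) : Prop :=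
  w j = C.op j (C.nodeVal x w (C.arg j 0)) (C.nodeVal x w (C.arg j 1))

/-- The equations of the cyclic xor-part hold. [cite: LiYang2022, §2.5] -/
def XorConsistent (x : Fin n → Bool) (w : Fin C.m → Bool) : Prop :=
  ∀ j ∈ C.xorPart, C.GateEq x w j

/-- The equations of the acyclic part hold. [cite: LiYang2022, §2.5] -/
def AcyclicConsistent (x : Fin n → Bool) (w : Fin C.m → Bool) : Prop :=
  ∀ j, j ∉ C.xorPart → C.GateEq x w j

variable {C} in
/-- All gate equations = xor-part equations and acyclic-part equations. [folklore] -/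
theorem consistent_iff_xor_acyclic {x : Fin n → Bool} {w : Fin C.m → Bool} :
    C.Consistent x w ↔ C.XorConsistent x w ∧ C.AcyclicConsistent x w :=
  ⟨fun h => ⟨fun j _ => h j, fun j _ => h j⟩, fun h j =>
    if hj : j ∈ C.xorPart then h.1 j hj else h.2 j hj⟩

/-- Node values agree when the gate values agree on the gates that occur. [folklore] -/
theorem nodeVal_congr (x : Fin n → Bool) {w w' : Fin C.m → Bool} {v : Node n C.m}
    (h : ∀ k, v = .gate k → w k = w' k) : C.nodeVal x w v = C.nodeVal x w' v := by
  cases v with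
  | const b => rfl
  | var i => rfl
  | gate k => exact h k rfl

variable {C} in
/-- The xor-part equations only involve the values on the xor-part. [cite: LiYang2022, Def. 2.5] -/
theorem XorConsistent.congr {x : Fin n → Bool} {w w' : Fin C.m → Bool} (hw : C.XorConsistent x w)
    (h : ∀ j ∈ C.xorPart, w' j = w j) : C.XorConsistent x w' := by
  intro j hj
  unfold GateEq
  rw [h j hj, hw j hj]
  congr 1
  · exact C.nodeVal_congr x fun k hk => (h k (C.mem_of_arg_eq j hj 0 k hk)).symm
  · exact C.nodeVal_congr x fun k hk => (h k (C.mem_of_arg_eq j hj 1 k hk)).symm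

/-! ### The acyclic part evaluates (existence and uniqueness of the extension) -/

/-- A rank function of the acyclic part (from `C.acyclic`). [cite: LiYang2022, Def. 2.5] -/
noncomputable def rank : Fin C.m → ℕ := Classical.choose C.acyclic

/-- The rank strictly increases along wires between gates of the acyclic part. [cite: LiYang2022, Def. 2.5] -/
theorem rank_lt {j : Fin C.m} (hj : j ∉ C.xorPart) {a : Fin 2} {k : Fin C.m} (h : C.arg j a = .gate k)
    (hk : k ∉ C.xorPart) : C.rank k < C.rank j :=
  Classical.choose_spec C.acyclic j hj a k h hk

/-- One relaxation step: recompute every gate of the acyclic part from the current values. [folklore] -/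
def relaxStep (x : Fin n → Bool) (w : Fin C.m → Bool) : Fin C.m → Bool :=
  fun j => if j ∈ C.xorPart then w j else C.op j (C.nodeVal x w (C.arg j 0)) (C.nodeVal x w (C.arg j 1))

/-- Iterated relaxation. [folklore] -/
def relax (x : Fin n → Bool) (w : Fin C.m → Bool) : ℕ → Fin C.m → Bool
  | 0 => w
  | t + 1 => C.relaxStep x (relax x w t)

/-- Relaxation does not touch the xor-part. [folklore] -/
theorem relax_of_mem (x : Fin n → Bool) (w : Fin C.m → Bool) {j : Fin C.m} (hj : j ∈ C.xorPart) :
    ∀ t, C.relax x w t j = w j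
  | 0 => rfl
  | t + 1 => by
    show C.relaxStep x (C.relax x w t) j = w j
    unfold relaxStep
    rw [if_pos hj, relax_of_mem x w hj t]

/-- The acyclic equations of rank `< t` hold. [folklore] -/
def GoodBelow (x : Fin n → Bool) (t : ℕ) (w : Fin C.m → Bool) : Prop :=
  ∀ j, j ∉ C.xorPart → C.rank j < t → C.GateEq x w j

/-- After one more relaxation step the equations of rank `< t + 1` hold. [folklore] -/
theorem goodBelow_relaxStep (x : Fin n → Bool) {t : ℕ} {w : Fin C.m → Bool} (hw : C.GoodBelow x t w) :
    C.GoodBelow x (t + 1) (C.relaxStep x w) := by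
  intro j hj hjt
  -- the inputs of `j` are unchanged by the step
  have hin : ∀ a, C.nodeVal x (C.relaxStep x w) (C.arg j a) = C.nodeVal x w (C.arg j a) := by
    intro a
    refine C.nodeVal_congr x fun k hk => ?_
    unfold relaxStep
    by_cases hkK : k ∈ C.xorPart
    · rw [if_pos hkK]
    · rw [if_neg hkK]
      have hlt : C.rank k < t := by have := C.rank_lt hj hk hkK; omega
      exact (hw k hkK hlt).symm
  unfold GateEq
  rw [hin 0, hin 1]
  unfold relaxStep
  rw [if_neg hj]

/-- After `t` relaxation steps the acyclic equations of rank `< t` hold. [folklore] -/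
theorem goodBelow_relax (x : Fin n → Bool) (w : Fin C.m → Bool) : ∀ t, C.GoodBelow x t (C.relax x w t)
  | 0 => fun _ _ h => absurd h (Nat.not_lt_zero _)
  | t + 1 => C.goodBelow_relaxStep x (goodBelow_relax x w t)

/-- **The acyclic part evaluates**: any values on the xor-part extend to values satisfying all
equations of the acyclic part. [cite: LiYang2022, Def. 2.5] -/
theorem exists_acyclicConsistent (x : Fin n → Bool) (u : Fin C.m → Bool) :
    ∃ w : Fin C.m → Bool, (∀ j ∈ C.xorPart, w j = u j) ∧ C.AcyclicConsistent x w := by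
  set T := (univ.sup C.rank) + 1 with hT
  refine ⟨C.relax x u T, fun j hj => C.relax_of_mem x u hj T, fun j hj => ?_⟩
  refine C.goodBelow_relax x u T j hj ?_
  have : C.rank j ≤ univ.sup C.rank := le_sup (f := C.rank) (mem_univ j)
  omega

/-- **Uniqueness of the extension**: values satisfying the acyclic equations are determined by
their restriction to the xor-part. [cite: LiYang2022, Def. 2.5] -/
theorem acyclicConsistent_unique (x : Fin n → Bool) {w w' : Fin C.m → Bool}
    (hw : C.AcyclicConsistent x w) (hw' : C.AcyclicConsistent x w')
    (hK : ∀ j ∈ C.xorPart, w j = w' j) : w = w' := by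
  suffices key : ∀ t j, C.rank j < t → w j = w' j by
    funext j; exact key _ j (Nat.lt_succ_self _)
  intro t
  induction t with
  | zero => intro j h; exact absurd h (Nat.not_lt_zero _)
  | succ t ih =>
    intro j hjt
    by_cases hj : j ∈ C.xorPart
    · exact hK j hj
    · rw [hw j hj, hw' j hj]
      have hin : ∀ a, C.nodeVal x w (C.arg j a) = C.nodeVal x w' (C.arg j a) := by
        intro a
        refine C.nodeVal_congr x fun k hk => ?_
        by_cases hkK : k ∈ C.xorPart
        · exact hK k hkK
        · exact ih k (by have := C.rank_lt hj hk hkK; omega)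
      rw [hin 0, hin 1]

/-! ### Fairness and the xor-part -/

variable {C} in
/-- **Under fairness the xor-part alone has unique solutions**: two solutions of the xor-part
equations on the same input agree on the xor-part. [cite: LiYang2022, §2.5] -/
theorem Fair.xor_unique (hF : C.Fair) {x : Fin n → Bool} {w w' : Fin C.m → Bool}
    (hw : C.XorConsistent x w) (hw' : C.XorConsistent x w') : ∀ j ∈ C.xorPart, w j = w' j := by
  obtain ⟨W, hWK, hWA⟩ := C.exists_acyclicConsistent x w
  obtain ⟨W', hWK', hWA'⟩ := C.exists_acyclicConsistent x w'
  have hWc : C.Consistent x W := consistent_iff_xor_acyclic.mpr ⟨hw.congr hWK, hWA⟩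
  have hWc' : C.Consistent x W' := consistent_iff_xor_acyclic.mpr ⟨hw'.congr hWK', hWA'⟩
  obtain ⟨w₀, -, huniq⟩ := hF x
  have hWW : W = W' := (huniq W hWc).trans (huniq W' hWc').symm
  intro j hj
  rw [← hWK j hj, ← hWK' j hj, hWW]

variable {C} in
/-- A solution of the xor-part equations extends to a solution of all equations. [cite: LiYang2022, §2.5] -/
theorem XorConsistent.exists_consistent {x : Fin n → Bool} {w : Fin C.m → Bool}
    (hw : C.XorConsistent x w) : ∃ W, C.Consistent x W ∧ ∀ j ∈ C.xorPart, W j = w j := by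
  obtain ⟨W, hWK, hWA⟩ := C.exists_acyclicConsistent x w
  exact ⟨W, consistent_iff_xor_acyclic.mpr ⟨hw.congr hWK, hWA⟩, hWK⟩

/-! ### The xor-part is affine -/

/-- Pointwise xor of three Boolean vectors. [folklore] -/
def xor3 {α : Type*} (f g h : α → Bool) : α → Bool := fun a => (f a ^^ g a) ^^ h a

/-- Node values of a xor of three value vectors (constants absorb: `b = b ⊕ b ⊕ b`). [folklore] -/
theorem nodeVal_xor3 (x₁ x₂ x₃ : Fin n → Bool) (w₁ w₂ w₃ : Fin C.m → Bool) (v : Node n C.m) :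
    C.nodeVal (xor3 x₁ x₂ x₃) (xor3 w₁ w₂ w₃) v =
      ((C.nodeVal x₁ w₁ v ^^ C.nodeVal x₂ w₂ v) ^^ C.nodeVal x₃ w₃ v) := by
  cases v with
  | const b => cases b <;> rfl
  | var i => rfl
  | gate k => rfl

variable {C} in
/-- **The xor-part equations are affine**: the xor of three solutions (on three inputs) is a
solution on the xor of the inputs. [cite: LiYang2022, §2.5] -/
theorem XorConsistent.xor3 {x₁ x₂ x₃ : Fin n → Bool} {w₁ w₂ w₃ : Fin C.m → Bool}
    (h₁ : C.XorConsistent x₁ w₁) (h₂ : C.XorConsistent x₂ w₂) (h₃ : C.XorConsistent x₃ w₃) :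
    C.XorConsistent (xor3 x₁ x₂ x₃) (xor3 w₁ w₂ w₃) := by
  intro j hj
  obtain ⟨c, hc⟩ := C.isXorOp_of_mem j hj
  unfold GateEq
  rw [nodeVal_xor3, nodeVal_xor3, hc]
  show ((w₁ j ^^ w₂ j) ^^ w₃ j) = _
  rw [h₁ j hj, h₂ j hj, h₃ j hj, hc, hc, hc]
  generalize C.nodeVal x₁ w₁ (C.arg j 0) = a₁
  generalize C.nodeVal x₂ w₂ (C.arg j 0) = a₂
  generalize C.nodeVal x₃ w₃ (C.arg j 0) = a₃
  generalize C.nodeVal x₁ w₁ (C.arg j 1) = b₁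
  generalize C.nodeVal x₂ w₂ (C.arg j 1) = b₂
  generalize C.nodeVal x₃ w₃ (C.arg j 1) = b₃
  cases a₁ <;> cases a₂ <;> cases a₃ <;> cases b₁ <;> cases b₂ <;> cases b₃ <;> cases c <;> rfl

/-- **The solution** of a fair semicircuit on input `x`. [cite: LiYang2022, §2.5] -/
noncomputable def sol (hF : C.Fair) (x : Fin n → Bool) : Fin C.m → Bool :=
  Classical.choose (hF x).exists

/-- The solution solves the gate equations. [cite: LiYang2022, §2.5] -/
theorem consistent_sol (hF : C.Fair) (x : Fin n → Bool) : C.Consistent x (C.sol hF x) :=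
  Classical.choose_spec (hF x).exists

variable {C} in
/-- Any solution is the solution. [cite: LiYang2022, §2.5] -/
theorem Consistent.eq_sol (hF : C.Fair) {x : Fin n → Bool} {w : Fin C.m → Bool} (hw : C.Consistent x w) :
    w = C.sol hF x :=
  (hF x).unique hw (C.consistent_sol hF x)

/-- **The solution map is affine on the xor-part**: `sol(x₁ ⊕ x₂ ⊕ x₃) = sol x₁ ⊕ sol x₂ ⊕ sol x₃`
there. [cite: LiYang2022, §2.5] -/
theorem sol_xor3 (hF : C.Fair) (x₁ x₂ x₃ : Fin n → Bool) {j : Fin C.m} (hj : j ∈ C.xorPart) :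
    C.sol hF (xor3 x₁ x₂ x₃) j = xor3 (C.sol hF x₁) (C.sol hF x₂) (C.sol hF x₃) j := by
  have h := ((consistent_iff_xor_acyclic.mp (C.consistent_sol hF x₁)).1.xor3
    (consistent_iff_xor_acyclic.mp (C.consistent_sol hF x₂)).1
    (consistent_iff_xor_acyclic.mp (C.consistent_sol hF x₃)).1)
  exact hF.xor_unique (consistent_iff_xor_acyclic.mp (C.consistent_sol hF _)).1 h j hj

/-- **Gate `I` of the xor-part depends on the variable `x_i`**: flipping `x_i` flips the value of
`I` (for an affine function: the coefficient of `x_i` is `1`; Li–Yang Prop. 2.7 "computing an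
affine function that depends on `x_i`"). [cite: LiYang2022, Prop. 2.7] -/
def DependsOn (hF : C.Fair) (I : Fin C.m) (i : Fin n) : Prop :=
  ∀ x : Fin n → Bool, C.sol hF (Function.update x i (!x i)) I ≠ C.sol hF x I

/-- Flipping `x_i` is xoring with the indicator of `i`. [folklore] -/
theorem update_not_eq_xor3 (x : Fin n → Bool) (i : Fin n) :
    Function.update x i (!x i) = xor3 x (fun _ => false) (fun i' => decide (i' = i)) := by
  funext i'
  unfold xor3
  by_cases h : i' = i
  · subst h; simp
  · simp [h]

/-- By affineness, dependence at one input implies dependence at every input. [cite: LiYang2022, Prop. 2.7] -/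
theorem dependsOn_of_exists (hF : C.Fair) {I : Fin C.m} (hI : I ∈ C.xorPart) {i : Fin n}
    (h : ∃ x : Fin n → Bool, C.sol hF (Function.update x i (!x i)) I ≠ C.sol hF x I) :
    C.DependsOn hF I i := by
  obtain ⟨x₀, hx₀⟩ := h
  intro x hx
  apply hx₀
  -- sol (x₀ ⊕ eᵢ) = sol x₀ ⊕ sol 0 ⊕ sol eᵢ and sol (x ⊕ eᵢ) = sol x ⊕ sol 0 ⊕ sol eᵢ on the xor-part
  have h1 := C.sol_xor3 hF x₀ (fun _ => false) (fun i' => decide (i' = i)) hI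
  have h2 := C.sol_xor3 hF x (fun _ => false) (fun i' => decide (i' = i)) hI
  rw [← update_not_eq_xor3] at h1 h2
  rw [h2] at hx
  rw [h1]
  unfold xor3 at hx ⊢
  revert hx
  generalize C.sol hF x₀ I = a
  generalize C.sol hF x I = b
  generalize C.sol hF (fun _ => false) I = c
  generalize C.sol hF (fun i' => decide (i' = i)) I = d
  cases a <;> cases b <;> cases c <;> cases d <;> decide

end Semicircuit

end Literature.Computability.Complexity
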